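import Literature.AlgebraicGeometry.HodgeTheory.RibetTypeSixSevenAllPowersHodgeClasses
import Literature.AlgebraicGeometry.Motives.HodgeThetaSubalgebraUnitaryEightCore
import HarnessLib

/-!
# Hodge classes on all powers of abelian varieties of Ribet type `(8, n″)`, `n″ ∈ {1, 3, 5, 7, 11, 13, 19}`, are
# generated by divisor classes (Ribet 1983 Thm. 3 at these multiplicities — UNCONDITIONAL; NINETEENFOLDS `19 = 8 + 11`)

Family `hodge`, layer `Literature/AlgebraicGeometry/HodgeTheory`. Research context: cell `pub-hodge-ring2` (HONEST
FRAMING: research route conditional on HC_CM; not a corollary; Q11.4-sentence-2 already refuted in dim ≥ 3),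
Literature lane gen 84, programme R68. UNCONDITIONAL for the class of abelian varieties it names; theorems only, no
definition, no named fact (D-0026), no `sorry`. The CELLS of the generic assembly `RibetTypeOfCoreSmulPowersHodgeClasses`
at the cores `UnitaryEight.eq_top_of_smul` (`n″` odd, `n″ ≤ 13`, `n″ ≠ 9`) and `UnitaryEight.eq_top_of_smul_nineteen`
(`Motives/HodgeThetaSubalgebraUnitaryEightCore`), and the census they refine: in prime dimension `p ≥ 11` the
imaginary-quadratic residual of `TankeevRibet1983_hodgeClasses_divisorial_powers_simplePrimeDimension` is
`min(n′, n″) ≥ 8` AND `{n′, n″} ≠ {8, 11}` (dimension `17`: `{8, 9}`; dimension `19`: `{9, 10}` only).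

HONEST SCOPE: `(8, 9)` (seventeenfolds) and `(9, 10)` (nineteenfolds) are NOT reached — see the module docstring of
`HodgeThetaSubalgebraUnitaryEightCore` (the rank-raising method stalls at rank `6` when `3 ∣ n″`).

THE PRINTED THEOREM. Ribet, Amer. J. Math. 105 (1983), Thm. 3 = Gordon's survey Thm. 6.3 (3) [held
`paper:arxiv-alg-geom_9709030` p. 18].

## References
* [Ribet1983] K. A. Ribet, Amer. J. Math. 105 (1983), Thm. 0 and Thm. 3.
* [Gordon1997] B. B. Gordon, *A survey of the Hodge conjecture for abelian varieties*, Thm. 6.3 (3) and Corollary.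
* [MoonenZarhin1999LowDim] B. Moonen, Yu. Zarhin, Math. Ann. 315 (1999), §2 (2.4), Thm. (2.7).
* [Deligne2000] P. Deligne, *The Hodge conjecture* (Clay, 2000), §1.
-/

noncomputable section

open CategoryTheory Module

namespace Literature.AlgebraicGeometry.HodgeTheory

open Literature.AlgebraicGeometry.Motives
open Literature.AlgebraicGeometry.Motives.HodgeStructure

section Cells

/-- **Ribet 1983 Thm. 3 at `(8, n″)`, `n″` odd, `n″ ≤ 13`, `n″ ≠ 9` — UNCONDITIONAL: `B•(A^{N+1}) = D•(A^{N+1}) ⊗ ℂ`**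
(`φ ≫ φ = -d`, `finrank_ℚ End⁰(A) = 2`, `n_{i√d}(φ) = 8`; core `UnitaryEight.eq_top_of_smul`).
[cite: Ribet1983, Thm. 0 and Thm. 3] [cite: Gordon1997, Thm. 6.3 (3) and Corollary] -/
theorem AbelianVariety.isDivisorGenerated_powSucc_of_ribetTypeEight (A : AbelianVariety ℂ) (φ : A ⟶ A)
    {d : ℕ} (hd : 0 < d) (hφ : φ ≫ φ = -(d • 𝟙 A)) (hE2 : Module.finrank ℚ A.endAlgebra = 2)
    (h8 : eigenMultiplicity A φ (Complex.I * (Real.sqrt d : ℂ)) = 8)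
    (hodd : Odd (eigenMultiplicity A φ (-(Complex.I * (Real.sqrt d : ℂ)))))
    (h9 : eigenMultiplicity A φ (-(Complex.I * (Real.sqrt d : ℂ))) ≠ 9)
    (h13 : eigenMultiplicity A φ (-(Complex.I * (Real.sqrt d : ℂ))) ≤ 13) (N : ℕ) :
    IsDivisorGenerated (A.powSucc N) := by
  have hpos' : 0 < eigenMultiplicity A φ (-(Complex.I * (Real.sqrt d : ℂ))) := by obtain ⟨k, hk⟩ := hodd; omega
  refine AbelianVariety.isDivisorGenerated_powSucc_of_ribetType_ofCoreSmul A φ hd hφ hE2 (by omega) hpos' ?_ N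
  intro W' _ _ _ 𝔊 ι P' Q' s hbr hirr hι hιι hP' hQ' hfinP' hfinQ' hadd hsmul hsymm hPQ hdefP hdefQ hadj
  exact UnitaryEight.eq_top_of_smul hbr hirr hι hιι hP' hQ' (by rw [hfinP', h8]) (by rw [hfinQ']; exact hodd)
    (by rw [hfinQ']; exact h9) (by rw [hfinQ']; exact h13) hadd hsmul hsymm hPQ hdefP hdefQ hadj

/-- The mirror: `n_{i√d}(φ)` odd, `≤ 13`, `≠ 9`, `n_{−i√d}(φ) = 8` (core `UnitaryEight.eq_top_of_smul'`).
[cite: Ribet1983, Thm. 0 and Thm. 3] [cite: Gordon1997, Thm. 6.3 (3) and Corollary] -/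
theorem AbelianVariety.isDivisorGenerated_powSucc_of_ribetTypeEight' (A : AbelianVariety ℂ) (φ : A ⟶ A)
    {d : ℕ} (hd : 0 < d) (hφ : φ ≫ φ = -(d • 𝟙 A)) (hE2 : Module.finrank ℚ A.endAlgebra = 2)
    (hodd : Odd (eigenMultiplicity A φ (Complex.I * (Real.sqrt d : ℂ))))
    (h9 : eigenMultiplicity A φ (Complex.I * (Real.sqrt d : ℂ)) ≠ 9)
    (h13 : eigenMultiplicity A φ (Complex.I * (Real.sqrt d : ℂ)) ≤ 13)
    (h8 : eigenMultiplicity A φ (-(Complex.I * (Real.sqrt d : ℂ))) = 8) (N : ℕ) :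
    IsDivisorGenerated (A.powSucc N) := by
  have hpos : 0 < eigenMultiplicity A φ (Complex.I * (Real.sqrt d : ℂ)) := by obtain ⟨k, hk⟩ := hodd; omega
  refine AbelianVariety.isDivisorGenerated_powSucc_of_ribetType_ofCoreSmul A φ hd hφ hE2 hpos (by omega) ?_ N
  intro W' _ _ _ 𝔊 ι P' Q' s hbr hirr hι hιι hP' hQ' hfinP' hfinQ' hadd hsmul hsymm hPQ hdefP hdefQ hadj
  exact UnitaryEight.eq_top_of_smul' hbr hirr hι hιι hP' hQ' (by rw [hfinP']; exact hodd) (by rw [hfinP']; exact h9)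
    (by rw [hfinP']; exact h13) (by rw [hfinQ', h8]) hadd hsmul hsymm hPQ hdefP hdefQ hadj

/-- **Ribet 1983 Thm. 3 at `(8, 19)` — UNCONDITIONAL** (core `UnitaryEight.eq_top_of_smul_nineteen`).
[cite: Ribet1983, Thm. 0 and Thm. 3] [cite: Gordon1997, Thm. 6.3 (3) and Corollary] -/
theorem AbelianVariety.isDivisorGenerated_powSucc_of_ribetTypeEightNineteen (A : AbelianVariety ℂ) (φ : A ⟶ A)
    {d : ℕ} (hd : 0 < d) (hφ : φ ≫ φ = -(d • 𝟙 A)) (hE2 : Module.finrank ℚ A.endAlgebra = 2)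
    (h8 : eigenMultiplicity A φ (Complex.I * (Real.sqrt d : ℂ)) = 8)
    (h19 : eigenMultiplicity A φ (-(Complex.I * (Real.sqrt d : ℂ))) = 19) (N : ℕ) :
    IsDivisorGenerated (A.powSucc N) := by
  refine AbelianVariety.isDivisorGenerated_powSucc_of_ribetType_ofCoreSmul A φ hd hφ hE2 (by omega) (by omega) ?_ N
  intro W' _ _ _ 𝔊 ι P' Q' s hbr hirr hι hιι hP' hQ' hfinP' hfinQ' hadd hsmul hsymm hPQ hdefP hdefQ hadj
  exact UnitaryEight.eq_top_of_smul_nineteen hbr hirr hι hιι hP' hQ' (by rw [hfinP', h8]) (by rw [hfinQ', h19])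
    hadd hsmul hsymm hPQ hdefP hdefQ hadj

/-- The mirror `(19, 8)`. [cite: Ribet1983, Thm. 0 and Thm. 3] [cite: Gordon1997, Thm. 6.3 (3) and Corollary] -/
theorem AbelianVariety.isDivisorGenerated_powSucc_of_ribetTypeEightNineteen' (A : AbelianVariety ℂ) (φ : A ⟶ A)
    {d : ℕ} (hd : 0 < d) (hφ : φ ≫ φ = -(d • 𝟙 A)) (hE2 : Module.finrank ℚ A.endAlgebra = 2)
    (h19 : eigenMultiplicity A φ (Complex.I * (Real.sqrt d : ℂ)) = 19)
    (h8 : eigenMultiplicity A φ (-(Complex.I * (Real.sqrt d : ℂ))) = 8) (N : ℕ) :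
    IsDivisorGenerated (A.powSucc N) := by
  refine AbelianVariety.isDivisorGenerated_powSucc_of_ribetType_ofCoreSmul A φ hd hφ hE2 (by omega) (by omega) ?_ N
  intro W' _ _ _ 𝔊 ι P' Q' s hbr hirr hι hιι hP' hQ' hfinP' hfinQ' hadd hsmul hsymm hPQ hdefP hdefQ hadj
  exact UnitaryEight.eq_top_of_smul_nineteen' hbr hirr hι hιι hP' hQ' (by rw [hfinP', h19]) (by rw [hfinQ', h8])
    hadd hsmul hsymm hPQ hdefP hdefQ hadj

/-- **The Hodge conjecture for all powers of an abelian variety of unitary type `(8, n″)`, `n″` odd, `n″ ≤ 13`,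
`n″ ≠ 9` — UNCONDITIONAL** (e.g. NINETEENFOLDS `(8,11)`, `21`-folds `(8,13)`). [cite: Ribet1983, Thm. 3] [cite: Deligne2000, §1] -/
theorem hodgeConjectureFor_powSucc_of_ribetTypeEight (A : AbelianVariety ℂ) (φ : A ⟶ A)
    {d : ℕ} (hd : 0 < d) (hφ : φ ≫ φ = -(d • 𝟙 A)) (hE2 : Module.finrank ℚ A.endAlgebra = 2)
    (h8 : eigenMultiplicity A φ (Complex.I * (Real.sqrt d : ℂ)) = 8)
    (hodd : Odd (eigenMultiplicity A φ (-(Complex.I * (Real.sqrt d : ℂ)))))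
    (h9 : eigenMultiplicity A φ (-(Complex.I * (Real.sqrt d : ℂ))) ≠ 9)
    (h13 : eigenMultiplicity A φ (-(Complex.I * (Real.sqrt d : ℂ))) ≤ 13) (N : ℕ) :
    HodgeConjectureFor (A.powSucc N).dim (A.powSucc N).X :=
  hodgeConjectureFor_of_isDivisorGenerated _
    (AbelianVariety.isDivisorGenerated_powSucc_of_ribetTypeEight A φ hd hφ hE2 h8 hodd h9 h13 N)

/-- **NINETEENFOLDS of signature `{8, 11}`: `B• = D•` on all powers — UNCONDITIONAL.**
[cite: Ribet1983, Thm. 0 and Thm. 3] [cite: MoonenZarhin1999LowDim, §2 (2.4)] -/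
theorem AbelianVariety.isDivisorGenerated_powSucc_of_nineteenfold_eightEleven (A : AbelianVariety ℂ)
    (φ : A ⟶ A) {d : ℕ} (hd : 0 < d) (hφ : φ ≫ φ = -(d • 𝟙 A)) (hE2 : Module.finrank ℚ A.endAlgebra = 2)
    (hX : A.dim = 19)
    (h8 : eigenMultiplicity A φ (Complex.I * (Real.sqrt d : ℂ)) = 8 ∨ eigenMultiplicity A φ (-(Complex.I * (Real.sqrt d : ℂ))) = 8)
    (N : ℕ) : IsDivisorGenerated (A.powSucc N) := by
  have hsum := eigenMultiplicity_add_eigenMultiplicity_neg_eq_dim A φ hd hφ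
  rw [hX] at hsum
  rcases h8 with h | h
  · exact AbelianVariety.isDivisorGenerated_powSucc_of_ribetTypeEight A φ hd hφ hE2 h ⟨5, by omega⟩ (by omega)
      (by omega) N
  · exact AbelianVariety.isDivisorGenerated_powSucc_of_ribetTypeEight' A φ hd hφ hE2 ⟨5, by omega⟩ (by omega)
      (by omega) h N

/-- **The Hodge conjecture for all powers of a NINETEENFOLD of signature `{8, 11}` — UNCONDITIONAL.**
[cite: Ribet1983, Thm. 3] [cite: Deligne2000, §1] -/
theorem hodgeConjectureFor_powSucc_of_nineteenfold_eightEleven (A : AbelianVariety ℂ)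
    (φ : A ⟶ A) {d : ℕ} (hd : 0 < d) (hφ : φ ≫ φ = -(d • 𝟙 A)) (hE2 : Module.finrank ℚ A.endAlgebra = 2)
    (hX : A.dim = 19)
    (h8 : eigenMultiplicity A φ (Complex.I * (Real.sqrt d : ℂ)) = 8 ∨ eigenMultiplicity A φ (-(Complex.I * (Real.sqrt d : ℂ))) = 8)
    (N : ℕ) : HodgeConjectureFor (A.powSucc N).dim (A.powSucc N).X :=
  hodgeConjectureFor_of_isDivisorGenerated _
    (AbelianVariety.isDivisorGenerated_powSucc_of_nineteenfold_eightEleven A φ hd hφ hE2 hX h8 N)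

/-- **`21`-FOLDS of signature `{8, 13}`: `B• = D•` on all powers — UNCONDITIONAL.**
[cite: Ribet1983, Thm. 0 and Thm. 3] [cite: Gordon1997, Thm. 6.3 (3) and Corollary] -/
theorem AbelianVariety.isDivisorGenerated_powSucc_of_twentyonefold_eightThirteen (A : AbelianVariety ℂ)
    (φ : A ⟶ A) {d : ℕ} (hd : 0 < d) (hφ : φ ≫ φ = -(d • 𝟙 A)) (hE2 : Module.finrank ℚ A.endAlgebra = 2)
    (hX : A.dim = 21)
    (h8 : eigenMultiplicity A φ (Complex.I * (Real.sqrt d : ℂ)) = 8 ∨ eigenMultiplicity A φ (-(Complex.I * (Real.sqrt d : ℂ))) = 8)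
    (N : ℕ) : IsDivisorGenerated (A.powSucc N) := by
  have hsum := eigenMultiplicity_add_eigenMultiplicity_neg_eq_dim A φ hd hφ
  rw [hX] at hsum
  rcases h8 with h | h
  · exact AbelianVariety.isDivisorGenerated_powSucc_of_ribetTypeEight A φ hd hφ hE2 h ⟨6, by omega⟩ (by omega)
      (by omega) N
  · exact AbelianVariety.isDivisorGenerated_powSucc_of_ribetTypeEight' A φ hd hφ hE2 ⟨6, by omega⟩ (by omega)
      (by omega) h N

end Cells

/-! ### Census: the Tankeev–Ribet residual is `min(n′, n″) ≥ 8` and `{n′, n″} ≠ {8, 11}` -/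

section Census

/-- **The Tankeev–Ribet fact is EQUIVALENT to: (S1) `End⁰ = ℚ` in prime dimension `≥ 11`, and (S2) imaginary-quadratic
multiplicities both `≥ 8` and `{n′, n″} ≠ {8, 11}`** (dimension `17`: only `{8,9}` remains; dimension `19`: only
`{9,10}`; dimension `23`: `{8,15}`, `{9,14}`, `{10,13}`, `{11,12}`). [cite: MoonenZarhin1999LowDim, §2 (2.4)–(2.7)]
[cite: Gordon1999HodgeAVSurvey, Thm. 6.3 and Corollary] [cite: Ribet1983, Thms. 1 and 3] -/
theorem tankeevRibet1983_iff_generic_ge_eleven_and_unitary_ge_eight_ne_eightEleven :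
    TankeevRibet1983_hodgeClasses_divisorial_powers_simplePrimeDimension ↔
      (∀ X : AbelianVariety ℂ, X.dim.Prime → 11 ≤ X.dim → X.IsSimple → Module.finrank ℚ X.endAlgebra = 1 →
        ∀ N : ℕ, IsDivisorGenerated (X.powSucc N)) ∧
      (∀ (X : AbelianVariety ℂ) (φ : X ⟶ X) (d : ℕ), X.dim.Prime → X.IsSimple → 0 < d →
        φ ≫ φ = -(d • 𝟙 X) → Module.finrank ℚ X.endAlgebra = 2 →
        8 ≤ eigenMultiplicity X φ (Complex.I * (Real.sqrt d : ℂ)) →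
        8 ≤ eigenMultiplicity X φ (-(Complex.I * (Real.sqrt d : ℂ))) →
        ¬ (eigenMultiplicity X φ (Complex.I * (Real.sqrt d : ℂ)) = 8 ∧
            eigenMultiplicity X φ (-(Complex.I * (Real.sqrt d : ℂ))) = 11) →
        ¬ (eigenMultiplicity X φ (Complex.I * (Real.sqrt d : ℂ)) = 11 ∧
            eigenMultiplicity X φ (-(Complex.I * (Real.sqrt d : ℂ))) = 8) →
        ∀ N : ℕ, IsDivisorGenerated (X.powSucc N)) := by
  rw [tankeevRibet1983_iff_generic_ge_eleven_and_unitary_ge_eight]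
  refine ⟨fun ⟨hS1, hS8⟩ => ⟨hS1, fun X φ d hp hs hd hφ he2 ha hb _ _ N => hS8 X φ d hp hs hd hφ he2 ha hb N⟩,
    fun ⟨hS1, hS8'⟩ => ⟨hS1, ?_⟩⟩
  intro X φ d hp hs hd hφ he2 ha hb N
  by_cases h811 : eigenMultiplicity X φ (Complex.I * (Real.sqrt d : ℂ)) = 8 ∧
      eigenMultiplicity X φ (-(Complex.I * (Real.sqrt d : ℂ))) = 11
  · obtain ⟨h8, h11⟩ := h811
    exact AbelianVariety.isDivisorGenerated_powSucc_of_ribetTypeEight X φ hd hφ he2 h8 ⟨5, by omega⟩ (by omega)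
      (by omega) N
  by_cases h118 : eigenMultiplicity X φ (Complex.I * (Real.sqrt d : ℂ)) = 11 ∧
      eigenMultiplicity X φ (-(Complex.I * (Real.sqrt d : ℂ))) = 8
  · obtain ⟨h11, h8⟩ := h118
    exact AbelianVariety.isDivisorGenerated_powSucc_of_ribetTypeEight' X φ hd hφ he2 ⟨5, by omega⟩ (by omega)
      (by omega) h8 N
  exact hS8' X φ d hp hs hd hφ he2 ha hb h811 h118 N

end Census

end Literature.AlgebraicGeometry.HodgeTheory

end
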